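import Summits.BirchSwinnertonDyer.BirchSwinnertonDyer.Theorems.SignedLowerHalvesSprungLowerDivisibilityAtThreeIotaDoorContraClosed
import Summits.BirchSwinnertonDyer.BirchSwinnertonDyer.Theorems.SignedLowerHalvesSprungLowerDivisibilityAtThreeCokerBoundByMassPoitouTateOfColMap
import HarnessLib

/-!
# Crux `SprungLowerDivisibilityAtThree` (item stmt-BirchSwinnertonDyer-19875), line `chromatic-common-zeros`: THE ι-DOORS OF THE TWIN CRUXES
# K′ = `PrintX8VSC.KatoFineLowerSporadicGivenHeldX8Contra` (item 23732) / C′ = `PrintX8VSC.CyclotomicLowerPosLevelGivenHeldX8Contra` (item 23733)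
# WITHOUT KATO'S THEOREM 12.4 — from TWO outside named facts {Poitou–Tate functional model, Matar 2020 Thm. 1.1} + the guard's Sprung Thm. 7.14

Cell `bsd-ssimc` (host), LEAD seat `cruxlead-stmt-BirchSwinnertonDyer-19875` (gen 9); theorems only (no `def`, no named fact, no instance); closes
NO item (`--supports` stmt-BirchSwinnertonDyer-19875). Part 3 of the door files `…IotaDoorContraClosed.lean` (LEAD g7 p674090) /
`…IotaDoorContraClosedOfThm714.lean` (LEAD g7 p675240). WHAT CHANGED: the width seat w3 (gen 10) proved the F-α♮′ cokernel bound of the ι-door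
from {PT functional model, Matar 1.1} + `h714` ALONE — `ChromaticCommonZeros.cokerBoundIotaOffT_contra_of_poitouTate_of_thm714'` (p677954): Kato 2004
Thm. 12.4 («𝐇¹ free of rank one») entered the earlier F-α♮′ only to make the mass skeleton's source cyclic, and is replaced there by
«𝐇¹ ↪ Λ through the ♯ Coleman map (injective when L♯ ≠ 0), 𝐇¹ ≠ 0, Λ a UFD ⟹ 𝐇¹ is 𝔭-locally cyclic at every height-one 𝔭» (p677645). The two
theorems below are p675240 §1/§2 VERBATIM with the hypothesis `(h124 : Kato2004.thm12_4)` deleted and the telescope call re-pointed at the primed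
F-α♮′; conclusions byte-identical, so the registered line skeletons on 23732 / 23733 (one research-residue stub each) and the by-name compositions
`PrintX8VSCIotaDoorContra.*_of_residue` / `*_iff_residue` (p675795 / p676553) re-thread to a TWO-fact door pack by a proof-only edit
(`… hF.1 hF.2.1 hF.2.2 h714` ↦ `…_of_poitouTate_of_matar_of_thm714 hF.1 hF.2.2 h714`, or `hF.1 hF.2` once the pack `HeldFactsIotaDoorX8Contra`
drops its middle conjunct — the route pen's call). HONEST FRAMING: compositions of landed lemmas; PT and Matar are PUBLISHED theorems typed
statement-only, displayed as hypotheses, never discharged; Kato 12.4 is true, merely no longer an input; K′, C′, their residues, K1, leaf X8 and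
BSD are NOT proved.

* §1 `iotaDoorContra_sporadic_of_poitouTate_of_matar_of_thm714 (hPT) (hMatar) (h714)` — K′'s door (sporadic `𝔭`, inside `k(𝔭) ≤ min_• j_•(ι𝔭)`).
* §2 `iotaDoorContra_posLevel_of_poitouTate_of_matar_of_thm714 (hPT) (hMatar) (h714)` — C′'s K-form door (`T ∉ 𝔭 ∋ Φ_{3^j}(1+T)`, `ι𝔭 = 𝔭`).

References: [Kato2004Asterisque] Conj. 12.10 (p. 224), (17.13.1) (p. 279–280); [Sprung2012] Thm. 7.14 (3) (p. 1504), Prop. 7.19, Main Conj. 7.21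
(p. 1505); [Matar2020] Thm. 1.1; [Wingberg1989] Cor. 2.5; [Kobayashi2003] Prop. 7.1, Thm. 7.3 i) (p. 13).
-/

set_option linter.dupNamespace false
set_option autoImplicit false

noncomputable section

open scoped Classical NumberField MatrixGroups ModularForm

open NumberField IsDedekindDomain CongruenceSubgroup WeierstrassCurve Field
  Literature.NumberTheory.EllipticCurves Literature.NumberTheory.EllipticCurves.ModularForms
  Literature.NumberTheory.EllipticCurves.ZpExtension Literature.NumberTheory.EllipticCurves.Sprung2017
  Literature.NumberTheory.EllipticCurves.Sprung2012 Literature.NumberTheory.EllipticCurves.Rank1Residual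
  Literature.NumberTheory.EllipticCurves.IwasawaAlgebra Literature.NumberTheory.EllipticCurves.Kato2004
  Literature.NumberTheory.EllipticCurves.Module
  Summit.BirchSwinnertonDyer.BirchSwinnertonDyer.Theorems

namespace Summit.BirchSwinnertonDyer.BirchSwinnertonDyer.Theorems.ChromaticCommonZeros

/-! ### §1 K′'s door from {PT, Matar} + Thm 7.14 -/

/-- **THE ι-DOOR IN PRINT CURRENCY, PROVED WITHOUT KATO 12.4** from two outside inputs (Sprung (3)/(7.18)∞ Poitou–Tate functional model,
Matar 2020 Thm 1.1) and the guard's Sprung Thm 7.14 (`h714`, supplying the fine dual's torsion on X8 and, with the (3)-package field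
`colMap_injective`, the embedding `𝐇¹ ↪ Λ`): at a sporadic height-one `𝔭` (`p ∉ 𝔭`, no `ω̃ₙ ∈ 𝔭`), common zero of both normalised colours,
INSIDE the door `ℓ_𝔭(I.H ⧸ Cs.Z) ≤ min_• ℓ_{ι𝔭}(Λ ⧸ range C•.colMap)`, Kato's fine inequality `ℓ_𝔭(I.H ⧸ Cs.Z) ≤ ℓ_𝔭 Y′.X` holds for the
natural-keyed `Y′ : FineSelmerDualData κ γ⁻¹`. Proof: the mirror prime `ι𝔭` is height one with `p, T ∉ ι𝔭`; if `ι𝔭` is a common zero,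
the primed Contra F-α♮′ telescope at `ι𝔭` (`ChromaticCommonZeros.cokerBoundIotaOffT_contra_of_poitouTate_of_thm714'`, w3 g10 p677954)
gives `j(ι𝔭) ≤ x′(ιι𝔭) = x′(𝔭)`; otherwise `j(ι𝔭) = 0`; either way `ChromaticCommonZeros.katoFineLowerAt_of_iotaDoor_contra` (w3 g9 p670914).
Same conclusion as `iotaDoorContra_sporadic_of_heldPack_of_thm714` (p675240), one hypothesis fewer.
[cite: Kato2004Asterisque, (17.13.1) (p. 279–280)] [cite: Sprung2012, Thm. 7.14 (3) (p. 1504)] [cite: Matar2020, Thm. 1.1]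
[cite: Kobayashi2003, Prop. 7.1, Thm. 7.3 i) (p. 13)] [cite: Wingberg1989, Cor. 2.5] -/
theorem iotaDoorContra_sporadic_of_poitouTate_of_matar_of_thm714 (hPT : thm714seq_sharpFlat_poitouTate_functionalModel)
    (hMatar : matar2020_thm11_selmerDualTorsion_pseudoIso_fineSelmerDual) (h714 : thm714_sharpFlatSelmerDual_finite_torsion) :
    ∀ (W : WeierstrassCurve ℚ) [W.IsElliptic] [W.IsGloballyMinimal] (p : ℕ) [Fact p.Prime]
      [ContinuousSMul ℤ_[p] (W.tateModule p)] [Module.Free ℤ_[p] (W.tateModule p)]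
      [Module.Finite ℤ_[p] (W.tateModule p)],
      ClassX8 W p → ∀ (κ : ZpExtension ℚ p) (γ : Field.absoluteGaloisGroup ℚ),
      κ.IsCyclotomic → κ.IsTopGenerator γ → IsCyclotomicVariable p γ →
    ∀ (v : HeightOneSpectrum (𝓞 ℚ)), (p : 𝓞 ℚ) ∈ v.asIdeal →
    ∀ (g : Field.absoluteGaloisGroup (v.adicCompletion ℚ)),
      κ.IsTopGenerator (resGalOfEmb (closureEmb (K := ℚ) (v.adicCompletion ℚ)) g) →
    ∀ (cneg : localPoints W (v.adicCompletion ℚ)) (c : ℕ → localPoints W (v.adicCompletion ℚ)),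
      IsHondaSystem κ (closureEmb (K := ℚ) (v.adicCompletion ℚ)) W (W.frobeniusTrace p) g cneg c →
    ∀ (N : ℕ) (_ : NeZero N) (f : CuspForm (Gamma0 N) 2) (ϖ : ℚ) (Lsharp Lflat : IwasawaAlgebra p),
      IsNewformOf W f → (ϖ : ℝ) * W.realPeriodRat = plusPeriod f →
      IsSprungPair f p (W.frobeniusTrace p) Lsharp Lflat →
    ∀ (I : Kato2004.IwasawaH1Data W p κ γ)
      (Cs : SharpFlatColemanKatoDataContra W p f ϖ κ γ (closureEmb (K := ℚ) (v.adicCompletion ℚ))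
        (W.frobeniusTrace p) g c Chroma.sharp I)
      (Cf : SharpFlatColemanKatoDataContra W p f ϖ κ γ (closureEmb (K := ℚ) (v.adicCompletion ℚ))
        (W.frobeniusTrace p) g c Chroma.flat I),
      Cs.Z = Cf.Z →
    ∀ (Y : W.FineSelmerDualData κ γ⁻¹) (𝔭 : PrimeSpectrum (IwasawaAlgebra p)), 𝔭.asIdeal.height = 1 →
      (p : IwasawaAlgebra p) ∉ 𝔭.asIdeal →
      (¬ ∃ n : ℕ, ((cyclotomicOmega p n).map (Int.castRingHom ℤ_[p]) : PowerSeries ℤ_[p]) ∈ 𝔭.asIdeal) →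
      (∀ (col' : Chroma) (G' : IwasawaAlgebra p),
        iwasawaToPowerSeries p G' =
          PowerSeries.C (ϖ : ℚ_[p]) * iwasawaToPowerSeries p (chromaticL col' Lsharp Lflat) →
        G' ∈ 𝔭.asIdeal) →
      Module.lengthAt (IwasawaAlgebra p) (I.H ⧸ Cs.Z) 𝔭 ≤
          min (Module.lengthAt (IwasawaAlgebra p) (IwasawaAlgebra p ⧸ LinearMap.range Cs.colMap)
                (PrimeSpectrum.comap (invol p).toRingHom 𝔭))
            (Module.lengthAt (IwasawaAlgebra p) (IwasawaAlgebra p ⧸ LinearMap.range Cf.colMap)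
                (PrimeSpectrum.comap (invol p).toRingHom 𝔭)) →
      Module.lengthAt (IwasawaAlgebra p) (I.H ⧸ Cs.Z) 𝔭 ≤ Module.lengthAt (IwasawaAlgebra p) Y.X 𝔭 := by
  intro W _ _ p _ _ _ _ hX κ γ hκ hγ hcv v hv g hg cneg c hH N hN f ϖ Lsharp Lflat hf hϖ hSP I Cs Cf hZ Y 𝔭 h𝔭 hp𝔭
    hspor hcommon hdoor
  haveI : NeZero N := hN
  -- `T ∉ 𝔭` (sporadic: `ω̃₀ = T`)
  have hT : (PowerSeries.X : IwasawaAlgebra p) ∉ 𝔭.asIdeal := fun hT =>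
    hspor ⟨0, by rwa [ChromaticCommonZeros.coe_map_cyclotomicOmega_zero]⟩
  -- the mirror prime `ι𝔭`: height one, `p ∉ ι𝔭`, `T ∉ ι𝔭`
  obtain ⟨h𝔮, hp𝔮⟩ := ChromaticCommonZeros.comap_invol_heightOne_not_mem 𝔭 h𝔭 hp𝔭
  have hT𝔮 := ChromaticCommonZeros.X_not_mem_comap_invol 𝔭 hT
  have hs : chromaticL Chroma.sharp Lsharp Lflat ≠ 0 :=
    ChromaticBothColours.ClassX8.chromaticL_ne_zero W p hX f Lsharp Lflat hf hSP Chroma.sharp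
  have hfl : chromaticL Chroma.flat Lsharp Lflat ≠ 0 :=
    ChromaticBothColours.ClassX8.chromaticL_ne_zero W p hX f Lsharp Lflat hf hSP Chroma.flat
  refine ChromaticCommonZeros.katoFineLowerAt_of_iotaDoor_contra W p Cs Cf (ClassX8.irr' W p hX) hSP hs hfl Y 𝔭
    (PrimeSpectrum.comap (invol p).toRingHom 𝔭) h𝔮 ?_ hdoor
  intro hcommon𝔮
  have h := ChromaticCommonZeros.cokerBoundIotaOffT_contra_of_poitouTate_of_thm714' hPT hMatar h714 W p hX κ γ hκ hγ
    hcv v hv g hg cneg c hH N hN f ϖ Lsharp Lflat hf hϖ hSP I Cs Cf hZ Y (PrimeSpectrum.comap (invol p).toRingHom 𝔭)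
    h𝔮 hp𝔮 hT𝔮 hcommon𝔮
  rwa [Kato2004.comap_invol_comap_invol] at h

/-! ### §2 C′'s K-form door from {PT, Matar} + Thm 7.14 -/

/-- **THE K-FORM DOOR AT A POSITIVE-LEVEL CYCLOTOMIC PRIME, WITHOUT KATO 12.4** — from two outside inputs (PT functional model,
Matar 1.1) and the guard's Thm 7.14 (`h714`: the fine dual's torsion on X8 and, with `colMap_injective`, `𝐇¹ ↪ Λ`): over the same binders as the
residue stub, at a height-one `𝔭` with `T ∉ 𝔭 ∋ Φ_{3^j}(1+T)` (`j ≥ 1`), common zero of both normalised colours, INSIDE the door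
`ℓ_𝔭(I.H ⧸ Cs.Z) ≤ min_• ℓ_𝔭(Λ ⧸ range C•.colMap)`: `ℓ_𝔭(I.H ⧸ Cs.Z) ≤ ℓ_𝔭 Y′.X`. Proof: `𝔭` is `ι`-fixed and `3 ∉ 𝔭`; the Contra F-α♮
telescope at `𝔭` in its primed form (`ChromaticCommonZeros.cokerBoundIotaOffT_contra_of_poitouTate_of_thm714'`, w3 g10 p677954) reads
`j(𝔭) ≤ x′(ι𝔭) = x′(𝔭)`; compose (`ChromaticCommonZeros.katoFineLowerAt_of_iotaDoor_contra_of_comap_invol_eq`, w3 g9 p670914).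
Same conclusion as `iotaDoorContra_posLevel_of_heldPack_of_thm714` (p675240), one hypothesis fewer.
[cite: Kato2004Asterisque, (17.13.1) (p. 279–280)] [cite: Sprung2012, Thm. 7.14 (3) (p. 1504)] [cite: Matar2020, Thm. 1.1]
[cite: Kobayashi2003, Prop. 7.1, Thm. 7.3 i) (p. 13)] [cite: Wingberg1989, Cor. 2.5] -/
theorem iotaDoorContra_posLevel_of_poitouTate_of_matar_of_thm714 (hPT : thm714seq_sharpFlat_poitouTate_functionalModel)
    (hMatar : matar2020_thm11_selmerDualTorsion_pseudoIso_fineSelmerDual) (h714 : thm714_sharpFlatSelmerDual_finite_torsion) :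
    ∀ (W : WeierstrassCurve ℚ) [W.IsElliptic] [W.IsGloballyMinimal] (p : ℕ) [Fact p.Prime]
      [ContinuousSMul ℤ_[p] (W.tateModule p)] [Module.Free ℤ_[p] (W.tateModule p)]
      [Module.Finite ℤ_[p] (W.tateModule p)],
      ClassX8 W p → ∀ (κ : ZpExtension ℚ p) (γ : Field.absoluteGaloisGroup ℚ),
      κ.IsCyclotomic → κ.IsTopGenerator γ → IsCyclotomicVariable p γ →
    ∀ (v : HeightOneSpectrum (𝓞 ℚ)), (p : 𝓞 ℚ) ∈ v.asIdeal →
    ∀ (g : Field.absoluteGaloisGroup (v.adicCompletion ℚ)),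
      κ.IsTopGenerator (resGalOfEmb (closureEmb (K := ℚ) (v.adicCompletion ℚ)) g) →
    ∀ (cneg : localPoints W (v.adicCompletion ℚ)) (c : ℕ → localPoints W (v.adicCompletion ℚ)),
      IsHondaSystem κ (closureEmb (K := ℚ) (v.adicCompletion ℚ)) W (W.frobeniusTrace p) g cneg c →
    ∀ (N : ℕ) (_ : NeZero N) (f : CuspForm (Gamma0 N) 2) (ϖ : ℚ) (Lsharp Lflat : IwasawaAlgebra p),
      IsNewformOf W f → (ϖ : ℝ) * W.realPeriodRat = plusPeriod f →
      IsSprungPair f p (W.frobeniusTrace p) Lsharp Lflat →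
    ∀ (I : Kato2004.IwasawaH1Data W p κ γ)
      (Cs : SharpFlatColemanKatoDataContra W p f ϖ κ γ (closureEmb (K := ℚ) (v.adicCompletion ℚ))
        (W.frobeniusTrace p) g c Chroma.sharp I)
      (Cf : SharpFlatColemanKatoDataContra W p f ϖ κ γ (closureEmb (K := ℚ) (v.adicCompletion ℚ))
        (W.frobeniusTrace p) g c Chroma.flat I),
      Cs.Z = Cf.Z →
    ∀ (Y : W.FineSelmerDualData κ γ⁻¹) (𝔭 : PrimeSpectrum (IwasawaAlgebra p)), 𝔭.asIdeal.height = 1 →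
      (PowerSeries.X : IwasawaAlgebra p) ∉ 𝔭.asIdeal →
      (∃ j : ℕ, 1 ≤ j ∧
        ((((Polynomial.cyclotomic (p ^ j) ℤ).comp (Polynomial.X + 1)).map (Int.castRingHom ℤ_[p]) : Polynomial ℤ_[p]) :
          PowerSeries ℤ_[p]) ∈ 𝔭.asIdeal) →
      (∀ (col' : Chroma) (G' : IwasawaAlgebra p),
        iwasawaToPowerSeries p G' =
          PowerSeries.C (ϖ : ℚ_[p]) * iwasawaToPowerSeries p (chromaticL col' Lsharp Lflat) →
        G' ∈ 𝔭.asIdeal) →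
      Module.lengthAt (IwasawaAlgebra p) (I.H ⧸ Cs.Z) 𝔭 ≤
          min (Module.lengthAt (IwasawaAlgebra p) (IwasawaAlgebra p ⧸ LinearMap.range Cs.colMap) 𝔭)
            (Module.lengthAt (IwasawaAlgebra p) (IwasawaAlgebra p ⧸ LinearMap.range Cf.colMap) 𝔭) →
      Module.lengthAt (IwasawaAlgebra p) (I.H ⧸ Cs.Z) 𝔭 ≤ Module.lengthAt (IwasawaAlgebra p) Y.X 𝔭 := by
  intro W _ _ p _ _ _ _ hX κ γ hκ hγ hcv v hv g hg cneg c hH N hN f ϖ Lsharp Lflat hf hϖ hSP I Cs Cf hZ Y 𝔭 h𝔭 hT hΦ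
    hcommon hdoor
  haveI : NeZero N := hN
  obtain ⟨j, hj1, hΦj⟩ := hΦ
  have hp3 : p = 3 := hX.1
  subst hp3
  -- `3 ∉ 𝔭` and `ι𝔭 = 𝔭` at a positive-level cyclotomic prime
  have hp𝔭 : ((3 : ℕ) : IwasawaAlgebra 3) ∉ 𝔭.asIdeal :=
    ChromaticCommonZeros.natCast_not_mem_of_cyclotomic_comp_mem 𝔭 h𝔭 hj1 hΦj
  have hfix : PrimeSpectrum.comap (invol 3).toRingHom 𝔭 = 𝔭 :=
    ChromaticCommonZeros.comap_invol_eq_self_of_cyclotomic_comp_mem 𝔭 h𝔭 hj1 hΦj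
  have hs : chromaticL Chroma.sharp Lsharp Lflat ≠ 0 :=
    ChromaticBothColours.ClassX8.chromaticL_ne_zero W 3 hX f Lsharp Lflat hf hSP Chroma.sharp
  have hfl : chromaticL Chroma.flat Lsharp Lflat ≠ 0 :=
    ChromaticBothColours.ClassX8.chromaticL_ne_zero W 3 hX f Lsharp Lflat hf hSP Chroma.flat
  refine ChromaticCommonZeros.katoFineLowerAt_of_iotaDoor_contra_of_comap_invol_eq W 3 Cs Cf (ClassX8.irr' W 3 hX) hSP hs hfl
    Y 𝔭 h𝔭 hfix ?_ hdoor
  intro hcommon'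
  exact ChromaticCommonZeros.cokerBoundIotaOffT_contra_of_poitouTate_of_thm714' hPT hMatar h714 W 3 hX κ γ hκ hγ hcv v hv
    g hg cneg c hH N hN f ϖ Lsharp Lflat hf hϖ hSP I Cs Cf hZ Y 𝔭 h𝔭 hp𝔭 hT hcommon'

end Summit.BirchSwinnertonDyer.BirchSwinnertonDyer.Theorems.ChromaticCommonZeros

end
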